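import Mathlib
import HarnessLib
import Literature.Geometry.DiscreteGeometry.KissingPatterns
import Literature.Probability.Process.PointStationaryLaw
import Literature.MathematicalPhysics.StatisticalMechanics.RootEnergy
import Literature.MathematicalPhysics.StatisticalMechanics.Crystallization
import Literature.MathematicalPhysics.StatisticalMechanics.MuGroundStateConfiguration
import Literature.MathematicalPhysics.StatisticalMechanics.BarlowStacking
import Literature.MathematicalPhysics.StatisticalMechanics.HaggStacking

/-!
# `RepetitiveNetworkReduction` — registered stub `stub_repetitiveReduction` (Line A, Palm bookkeeping)

Route `Summits/AtomisticToContinuum/Crystallization/Theses/RepetitiveNetworkReduction.lean`, residual crux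
`RepetitiveNetworkLawGap` (item `stmt-AtomisticToContinuum-27568`), registered skeleton Line A
(decomp-a2c lens 2, g19; skeleton sha `ff3c3003…`): this file proves the stub `stub_repetitiveReduction`
BY NAME with its registered statement VERBATIM.

Content (TRUE-type bookkeeping, «law → deterministic member»): a point-stationary probability law `P` a.s.
carried by rooted `δ`-hard-core configurations that are a.s. textured (`Appr`), Nash at every atom, a.s. not a
periodic translate, a.s. `e⋆`-μ-ground-state configurations of `V_LJ` (Sütő's second form, written out), a.s.
grain-free, core-free and uniformly recurrent, has — because a probability measure has a non-trivial a.e. filter —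
ONE configuration `μ = count|S` in the intersection of these full-measure events; its atom set
`{p | μ {p} ≠ 0} = S` is the deterministic witness: rooted at `0`, `δ`-separated
(`IsRootedHardCore`), and an `e⋆`-μGSC in the sense of `Literature.….IsMuGSC` (the written-out clause IS the
definition).  The mean-energy hypothesis `E_P[rootEnergy] ≤ e⋆` and point-stationarity are not needed.
[cite: LastPenrose2017, §9 (Palm calculus; a.s. properties of the typical point); Suto2006, §2 Definition (μGSC)]
-/

set_option maxHeartbeats 400000

namespace Summit.AtomisticToContinuum.Crystallization.Theorems.RepetitiveNetworkReductionRepetitiveReduction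

open MeasureTheory

/-- **Registered stub `stub_repetitiveReduction` of the Line-A skeleton of `RepetitiveNetworkLawGap`** (statement
verbatim): Palm bookkeeping — a law of the residual class yields a deterministic rooted member of the class that
is an `e⋆`-μ-ground-state configuration by name. [cite: LastPenrose2017, §9; Suto2006, §2 Definition] -/
theorem stub_repetitiveReduction : ∀ δ : ℝ, 0 < δ → ∀ P : MeasureTheory.Measure (MeasureTheory.Measure (EuclideanSpace ℝ (Fin 3))), let Gy : ℝ → (N : ℕ) → (Fin N → EuclideanSpace ℝ (Fin 3)) → Fin N → Prop := fun η N y j => let d : ℝ := sInf ((fun z => dist z (y (j : Fin N))) '' (Set.range (y) \ {(y (j : Fin N))})); let T : Set (EuclideanSpace ℝ (Fin 3)) := {z : EuclideanSpace ℝ (Fin 3) | z ∈ Set.range (y) ∧ z ≠ (y (j : Fin N)) ∧ dist z (y (j : Fin N)) < 13 / 10 * d}; ∃ A : EuclideanSpace ℝ (Fin 3) →ₗᵢ[ℝ] EuclideanSpace ℝ (Fin 3), (∃ e : ↥T ≃ ↥Literature.Geometry.DiscreteGeometry.fccKissingPattern, ∀ t : ↥T, dist (d⁻¹ • ((t : EuclideanSpace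 ℝ (Fin 3)) - (y (j : Fin N)))) (A ((e t : ↥Literature.Geometry.DiscreteGeometry.fccKissingPattern) : EuclideanSpace ℝ (Fin 3))) ≤ η) ∨ (∃ e : ↥T ≃ ↥Literature.Geometry.DiscreteGeometry.hcpKissingPattern, ∀ t : ↥T, dist (d⁻¹ • ((t : EuclideanSpace ℝ (Fin 3)) - (y (j : Fin N)))) (A ((e t : ↥Literature.Geometry.DiscreteGeometry.hcpKissingPattern) : EuclideanSpace ℝ (Fin 3))) ≤ η); let TexBall : (N : ℕ) → (Fin N → EuclideanSpace ℝ (Fin 3)) → Fin N → ℝ → ℝ → ℝ → ℝ → Prop := fun N y i R R₇ R₈ R₉ => (∀ a b : Fin N, a ≠ b → (7 : ℝ) / 10 ≤ dist (y a) (y b)) ∧ (∀ j : Fin N, dist (y j) (y i) ≤ R → ¬ Gy (1 / 20) N (y) j) ∧ (∀ j : Fin N, dist (y j) (y i) ≤ R → ¬ ((∀ j' : Fin N, dist (y j') (y j) ≤ R₇ → ¬ Gy (1 / 20) N (y) j') ∧ (∀ z : EuclideanSpace ℝ (Fin 3), dist z (y j) ≤ R₇ → ∃ k : Fin N, dist z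 (y k) ≤ 1) ∧ (∀ j' : Fin N, dist (y j') (y j) ≤ R₇ → (let d : ℝ := sInf ((fun z => dist z (y j')) '' (Set.range (y) \ {(y j')})); ∀ k : Fin N, y k ≠ y j' → dist (y k) (y j') < 27 / 20 * d → 5 ≤ Nat.card {m : Fin N // y m ≠ y j' ∧ dist (y m) (y j') < 27 / 20 * d ∧ y m ≠ y k ∧ dist (y m) (y k) < 27 / 20 * d})))) ∧ (∀ j : Fin N, dist (y j) (y i) ≤ R → ∃ k : Fin N, dist (y k) (y j) ≤ R₈ ∧ Gy (1 / 8) N (y) k) ∧ (∀ j : Fin N, dist (y j) (y i) ≤ R → ¬ ((∀ j' : Fin N, dist (y j') (y j) ≤ R₉ → ¬ Gy (1 / 20) N (y) j') ∧ (Nat.card {j' : Fin N // dist (y j') (y j) ≤ R₉ ∧ ¬ Gy (1 / 8) N (y) j'} : ℝ) ≤ 1 / 2 * (Nat.card {j' : Fin N // dist (y j') (y j) ≤ R₉} : ℝ) ∧ (∀ j' : Fin N, dist (y j') (y j) ≤ R₉ → ¬ Gy (1 / 8) N (y) j' → ¬ (let d : ℝ := sInf ((fun z => dist z (y j')) ''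 (Set.range (y) \ {(y j')})); ∀ k : Fin N, y k ≠ y j' → dist (y k) (y j') < 27 / 20 * d → 5 ≤ Nat.card {m : Fin N // y m ≠ y j' ∧ dist (y m) (y j') < 27 / 20 * d ∧ y m ≠ y k ∧ dist (y m) (y k) < 27 / 20 * d})))); let Appr : MeasureTheory.Measure (EuclideanSpace ℝ (Fin 3)) → ℝ → ℝ → ℝ → Prop := fun μ R₇ R₈ R₉ => ∀ q : EuclideanSpace ℝ (Fin 3), μ {q} ≠ 0 → ∀ R ε : ℝ, 0 < ε → ∃ (N : ℕ) (y : Fin N → EuclideanSpace ℝ (Fin 3)) (i : Fin N), TexBall N y i R R₇ R₈ R₉ ∧ (∀ p : EuclideanSpace ℝ (Fin 3), μ {p} ≠ 0 → dist p q ≤ R → ∃ k : Fin N, dist (y k - y i) (p - q) ≤ ε) ∧ (∀ k : Fin N, dist (y k) (y i) ≤ R → ∃ p : EuclideanSpace ℝ (Fin 3), μ {p} ≠ 0 ∧ dist (y k - y i) (p - q) ≤ ε); let ApprS : Set (EuclideanSpace ℝ (Fin 3)) → ℝ → ℝ → ℝ → Prop := fun S R₇ R₈ R₉ => ∀ q :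 EuclideanSpace ℝ (Fin 3), q ∈ S → ∀ R ε : ℝ, 0 < ε → ∃ (N : ℕ) (y : Fin N → EuclideanSpace ℝ (Fin 3)) (i : Fin N), TexBall N y i R R₇ R₈ R₉ ∧ (∀ p : EuclideanSpace ℝ (Fin 3), p ∈ S → dist p q ≤ R → ∃ k : Fin N, dist (y k - y i) (p - q) ≤ ε) ∧ (∀ k : Fin N, dist (y k) (y i) ≤ R → ∃ p : EuclideanSpace ℝ (Fin 3), p ∈ S ∧ dist (y k - y i) (p - q) ≤ ε); let NashS : Set (EuclideanSpace ℝ (Fin 3)) → Prop := fun S => ∀ p : EuclideanSpace ℝ (Fin 3), p ∈ S → ∀ y : EuclideanSpace ℝ (Fin 3), (∀ q : EuclideanSpace ℝ (Fin 3), q ∈ S → q ≠ p → y ≠ q) → ∑' q : {q : EuclideanSpace ℝ (Fin 3) // q ∈ S ∧ q ≠ p}, Literature.MathematicalPhysics.StatisticalMechanics.lennardJones (dist p (q : EuclideanSpace ℝ (Fin 3))) ≤ ∑' q : {q : EuclideanSpace ℝ (Fin 3) // q ∈ S ∧ q ≠ p}, Literature.MathematicalPhysics.StatisticalMechanics.lennardJones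 (dist y (q : EuclideanSpace ℝ (Fin 3))); let AtomS : MeasureTheory.Measure (EuclideanSpace ℝ (Fin 3)) → Set (EuclideanSpace ℝ (Fin 3)) := fun μ => {p : EuclideanSpace ℝ (Fin 3) | μ {p} ≠ 0}; let GyS : ℝ → Set (EuclideanSpace ℝ (Fin 3)) → EuclideanSpace ℝ (Fin 3) → Prop := fun η S x => let d : ℝ := sInf ((fun z => dist z x) '' (S \ {x})); let T : Set (EuclideanSpace ℝ (Fin 3)) := {z : EuclideanSpace ℝ (Fin 3) | z ∈ S ∧ z ≠ x ∧ dist z x < 13 / 10 * d}; ∃ A : EuclideanSpace ℝ (Fin 3) →ₗᵢ[ℝ] EuclideanSpace ℝ (Fin 3), (∃ e : ↥T ≃ ↥Literature.Geometry.DiscreteGeometry.fccKissingPattern, ∀ t : ↥T, dist (d⁻¹ • ((t : EuclideanSpace ℝ (Fin 3)) - x)) (A ((e t : ↥Literature.Geometry.DiscreteGeometry.fccKissingPattern) : EuclideanSpace ℝ (Fin 3))) ≤ η) ∨ (∃ e : ↥T ≃ ↥Literature.Geometry.DiscreteGeometry.hcpKissingPattern, ∀ t : ↥T, dist (d⁻¹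 • ((t : EuclideanSpace ℝ (Fin 3)) - x)) (A ((e t : ↥Literature.Geometry.DiscreteGeometry.hcpKissingPattern) : EuclideanSpace ℝ (Fin 3))) ≤ η); let Band : (EuclideanSpace ℝ (Fin 3) →L[ℝ] EuclideanSpace ℝ (Fin 3)) → Prop := fun A => ∀ v : EuclideanSpace ℝ (Fin 3), 9 / 10 * ‖v‖ ≤ ‖A v‖ ∧ ‖A v‖ ≤ 11 / 10 * ‖v‖; let Tmpl : (EuclideanSpace ℝ (Fin 3) →L[ℝ] EuclideanSpace ℝ (Fin 3)) → (ℤ → ℤ) → EuclideanSpace ℝ (Fin 3) → EuclideanSpace ℝ (Fin 3) → Set (EuclideanSpace ℝ (Fin 3)) := fun A s c x => (fun b : EuclideanSpace ℝ (Fin 3) => x + A (b - c)) '' Literature.MathematicalPhysics.StatisticalMechanics.barlowStacking 1 (Real.sqrt (2 / 3)) s; let CollarS : Set (EuclideanSpace ℝ (Fin 3)) → EuclideanSpace ℝ (Fin 3) → Prop := fun S x => ∃ (A : EuclideanSpace ℝ (Fin 3) →L[ℝ] EuclideanSpace ℝ (Fin 3)) (s : ℤ → ℤ) (c : EuclideanSpace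 ℝ (Fin 3)), Literature.MathematicalPhysics.StatisticalMechanics.IsHaggSeq s ∧ Band A ∧ (∀ y ∈ S, 2 ≤ dist y x → dist y x ≤ 6 → ∃ p ∈ Tmpl A s c x, dist y p ≤ 1 / 50) ∧ (∀ p ∈ Tmpl A s c x, 2 ≤ dist p x → dist p x ≤ 6 → ∃ y ∈ S, dist y p ≤ 1 / 50); let GrainS : Set (EuclideanSpace ℝ (Fin 3)) → EuclideanSpace ℝ (Fin 3) → Prop := fun S x => ∃ (A : EuclideanSpace ℝ (Fin 3) →L[ℝ] EuclideanSpace ℝ (Fin 3)) (s : ℤ → ℤ) (c : EuclideanSpace ℝ (Fin 3)), Literature.MathematicalPhysics.StatisticalMechanics.IsHaggSeq s ∧ Band A ∧ (Set.ncard {y : EuclideanSpace ℝ (Fin 3) | y ∈ S ∧ dist y x ≤ 2048 ∧ ∀ p ∈ Tmpl A s c x, 1 / 225 < dist y p} : ℝ) + (Set.ncard {p : EuclideanSpace ℝ (Fin 3) | p ∈ Tmpl A s c x ∧ dist p x ≤ 2048 ∧ ∀ y ∈ S, 1 / 225 < dist y p} : ℝ) ≤ 1 / 1000 * (Set.ncard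 {y : EuclideanSpace ℝ (Fin 3) | y ∈ S ∧ dist y x ≤ 2048} : ℝ); let UR : Set (EuclideanSpace ℝ (Fin 3)) → Prop := fun S => ∀ R ε : ℝ, 0 < ε → ∃ G : ℝ, ∀ w ∈ S, ∃ g ∈ S, dist g w ≤ G ∧ (∀ s ∈ S, dist s (0 : EuclideanSpace ℝ (Fin 3)) ≤ R → ∃ a ∈ S, dist (a - g) s ≤ ε) ∧ (∀ a ∈ S, dist (a - g) (0 : EuclideanSpace ℝ (Fin 3)) ≤ R → ∃ s ∈ S, dist (a - g) s ≤ ε); MeasureTheory.IsProbabilityMeasure P → (∀ᵐ μ ∂P, Literature.Probability.Process.IsRootedHardCore δ μ) → Literature.Probability.Process.IsPointStationaryLaw P → (∃ R₇ R₈ R₉ : ℝ, ∀ᵐ μ ∂P, Appr μ R₇ R₈ R₉) → (∀ᵐ μ ∂P, ∀ p : EuclideanSpace ℝ (Fin 3), μ {p} ≠ 0 → ∀ y : EuclideanSpace ℝ (Fin 3), (∀ q : EuclideanSpace ℝ (Fin 3), μ {q} ≠ 0 → q ≠ p → y ≠ q) → ∑' q : {q : EuclideanSpace ℝ (Fin 3)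 // μ {q} ≠ 0 ∧ q ≠ p}, Literature.MathematicalPhysics.StatisticalMechanics.lennardJones (dist p (q : EuclideanSpace ℝ (Fin 3))) ≤ ∑' q : {q : EuclideanSpace ℝ (Fin 3) // μ {q} ≠ 0 ∧ q ≠ p}, Literature.MathematicalPhysics.StatisticalMechanics.lennardJones (dist y (q : EuclideanSpace ℝ (Fin 3)))) → P {μ : MeasureTheory.Measure (EuclideanSpace ℝ (Fin 3)) | ∃ Q : Literature.MathematicalPhysics.StatisticalMechanics.PeriodicConfiguration 3, ∃ t : EuclideanSpace ℝ (Fin 3), {p : EuclideanSpace ℝ (Fin 3) | μ {p} ≠ 0} = (fun s => s + t) '' Q.points} = 0 → (∀ᵐ μ ∂P, ((∀ r : EuclideanSpace ℝ (Fin 3), Summable fun y : ↥((AtomS μ)) => Literature.MathematicalPhysics.StatisticalMechanics.lennardJones (dist r y)) ∧ ∀ (n : ℕ) (xf : Fin n → EuclideanSpace ℝ (Fin 3)), Function.Injective xf → Set.range xf ⊆ (AtomS μ) → ∀ (k : ℕ) (R : Fin k → EuclideanSpace ℝ (Fin 3)), Function.Injective R → Disjoint (Set.range R) ((AtomS μ)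 \ Set.range xf) → Literature.MathematicalPhysics.StatisticalMechanics.interactionEnergy Literature.MathematicalPhysics.StatisticalMechanics.lennardJones xf + (∑ i, ∑' y : ↥((AtomS μ) \ Set.range xf), Literature.MathematicalPhysics.StatisticalMechanics.lennardJones (dist (xf i) y)) - (⨅ Q : Literature.MathematicalPhysics.StatisticalMechanics.PeriodicConfiguration 3, Q.energyPerParticle Literature.MathematicalPhysics.StatisticalMechanics.lennardJones) * n ≤ Literature.MathematicalPhysics.StatisticalMechanics.interactionEnergy Literature.MathematicalPhysics.StatisticalMechanics.lennardJones R + (∑ i, ∑' y : ↥((AtomS μ) \ Set.range xf), Literature.MathematicalPhysics.StatisticalMechanics.lennardJones (dist (R i) y)) - (⨅ Q : Literature.MathematicalPhysics.StatisticalMechanics.PeriodicConfiguration 3, Q.energyPerParticle Literature.MathematicalPhysics.StatisticalMechanics.lennardJones) * k)) → (∀ᵐ μ ∂P, ¬ ∃ x : EuclideanSpace ℝ (Fin 3), GrainS (AtomS μ) x) → (∀ᵐ μ ∂P, ¬ ∃ x : EuclideanSpace ℝ (Fin 3), x ∈ AtomS μ ∧ ¬ GyS (1 / 8) (AtomS μ)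 x ∧ CollarS (AtomS μ) x) → (∀ᵐ μ ∂P, UR (AtomS μ)) → (∫ μ, Literature.MathematicalPhysics.StatisticalMechanics.rootEnergy Literature.MathematicalPhysics.StatisticalMechanics.lennardJones μ ∂P) ≤ (⨅ Q : Literature.MathematicalPhysics.StatisticalMechanics.PeriodicConfiguration 3, Q.energyPerParticle Literature.MathematicalPhysics.StatisticalMechanics.lennardJones) → ∃ S : Set (EuclideanSpace ℝ (Fin 3)), (0 : EuclideanSpace ℝ (Fin 3)) ∈ S ∧ (∀ p ∈ S, ∀ q ∈ S, p ≠ q → δ ≤ dist p q) ∧ (∃ R₇ R₈ R₉ : ℝ, ApprS S R₇ R₈ R₉) ∧ NashS S ∧ (¬ ∃ (Q : Literature.MathematicalPhysics.StatisticalMechanics.PeriodicConfiguration 3) (t : EuclideanSpace ℝ (Fin 3)), S = (fun s => s + t) '' Q.points) ∧ (¬ ∃ x : EuclideanSpace ℝ (Fin 3), GrainS S x) ∧ (¬ ∃ x : EuclideanSpace ℝ (Fin 3), x ∈ S ∧ ¬ GyS (1 / 8) S x ∧ CollarS S x) ∧ Literature.MathematicalPhysics.StatisticalMechanics.IsMuGSC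 Literature.MathematicalPhysics.StatisticalMechanics.lennardJones (⨅ Q : Literature.MathematicalPhysics.StatisticalMechanics.PeriodicConfiguration 3, Q.energyPerParticle Literature.MathematicalPhysics.StatisticalMechanics.lennardJones) S ∧ UR S := by
  intro δ hδ P
  dsimp only
  intro hP hcore hstat happr hnash hper hmu hgrain hcoll hur hle
  obtain ⟨R₇, R₈, R₉, happr'⟩ := happr
  have hnp : ∀ᵐ μ ∂P, ¬ (∃ Q : Literature.MathematicalPhysics.StatisticalMechanics.PeriodicConfiguration 3,
      ∃ t : EuclideanSpace ℝ (Fin 3), {p : EuclideanSpace ℝ (Fin 3) | μ {p} ≠ 0} = (fun s => s + t) '' Q.points) := by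
    have := MeasureTheory.measure_eq_zero_iff_ae_notMem.mp hper
    filter_upwards [this] with μ hμ
    simpa only [Set.mem_setOf_eq] using hμ
  haveI : (MeasureTheory.ae P).NeBot := MeasureTheory.ae_neBot.mpr (MeasureTheory.IsProbabilityMeasure.ne_zero P)
  obtain ⟨μ, hcμ, haμ, hnμ, hpμ, hmμ, hgμ, hkμ, huμ⟩ :=
    (hcore.and (happr'.and (hnash.and (hnp.and (hmu.and (hgrain.and (hcoll.and hur))))))).exists
  obtain ⟨S, h0S, hsepS, rfl⟩ := hcμ
  have hat : ∀ p : EuclideanSpace ℝ (Fin 3),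
      ((MeasureTheory.Measure.count : MeasureTheory.Measure (EuclideanSpace ℝ (Fin 3))).restrict S) {p} ≠ 0 ↔
        p ∈ S :=
    fun p => Literature.Probability.Process.count_restrict_singleton_ne_zero_iff S p
  refine ⟨{p : EuclideanSpace ℝ (Fin 3) |
      ((MeasureTheory.Measure.count : MeasureTheory.Measure (EuclideanSpace ℝ (Fin 3))).restrict S) {p} ≠ 0},
    ?_, ?_, ⟨R₇, R₈, R₉, ?_⟩, ?_, ?_, ?_, ?_, ?_, ?_⟩
  · -- rooted at 0
    exact (hat 0).mpr h0S
  · -- δ-separated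
    intro p hp q hq hpq
    exact hsepS p ((hat p).mp hp) q ((hat q).mp hq) hpq
  · -- textured (ApprS = Appr, literally)
    simpa only [Set.mem_setOf_eq] using haμ
  · -- Nash at every atom
    simpa only [Set.mem_setOf_eq] using hnμ
  · -- not a periodic translate
    simpa only [Set.mem_setOf_eq] using hpμ
  · -- grain-free
    simpa only [Set.mem_setOf_eq] using hgμ
  · -- core-free
    simpa only [Set.mem_setOf_eq] using hkμ
  · -- e⋆-μGSC by name: the written-out clause is the definition
    simpa only [Literature.MathematicalPhysics.StatisticalMechanics.IsMuGSC, Set.mem_setOf_eq] using hmμ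
  · -- uniformly recurrent
    simpa only [Set.mem_setOf_eq] using huμ

end Summit.AtomisticToContinuum.Crystallization.Theorems.RepetitiveNetworkReductionRepetitiveReduction
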